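import Mathlib
import HarnessLib
import HarnessLib.Audit
import Summits.PneNP.Statement
import Literature.Combinatorics.Optimization.TracialDesigns
import Literature.Barriers.PneNP.MatchingSlackPsdApproximation
import Literature.Combinatorics.Optimization.PatternMatrixPsdRank
import Literature.Barriers.PneNP.TSPExtensionComplexityRothvossAssembly
import Summits.PneNP.MatchingPsdRank.Conjectures.MatchingPsdRankStretchedExp

/-!
Route: ChebyshevTracialDesign

DORMANT since 2026-09-03T21:13:03Z (reconciler: no traction for 5 d (last activity item-evidence-added at 2026-08-29T20:26:59Z); parked, not closed — `ledger route dormant route-PneNP-ChebyshevTracialDesign --off` to reactivate) — unstaffed, not closed; items shared with open routes are served there. `ledger route dormant <id> --off` reactivates.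

# Route ChebyshevTracialDesign — Chebyshev extrapolation designs give stretched-exponential psd rank
of the matching slack

Rung F-N2 of the pnp-psdrank ladder (D-0059/D-0061 rung route; alt-closer leaf
`MatchingPsdRankStretchedExp`, p404813: the odd-cut slack
matrix `S(U,M) = |δ(U) ∩ M| − 1` of the perfect matching polytope of `K_n` has no psd factorization
of size `< exp(c·n^δ)`). It suffices
to show X = X_decay ∧ X_design: X_design (`ChebyshevDesign20`) = for all large even n there is a
BALANCED EXACT EXTRAPOLATION DESIGN —
weights `w_c` on the odd crossing levels `3 ≤ c ≤ T(n) = 4⌊√n⌋+3` of Rothvoß's `t`-cuts (`n/4 ≤ t <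
n/2`), exact at the parity-forbidden
virtual level `c = 0` for every polynomial of degree `≤ D(n) = ⌊n^{1/4}⌋` (`Σ_c w_c p(c) = −p(0)`),
normalised `Σ_c w_c (c−1) = 1`, of total
variation `Σ|w_c| ≤ 20`; X_decay (`TracialDecayExp20`, THE crux, stmt-PneNP-19878 — the
EXP-normalised form, deciding since rev 3) = for some `a > 0` every
such design has tracial value `≤ exp(−a·D(n))` on tight-orthogonal psd rectangles (`0 ⪯ X_U, Y_M ⪯
I`, `X_U Y_M = 0` when `|δ(U) ∩ M| = 1`)
of every dimension `r ≥ 1` with `r²·n < exp(a·D(n))`. (The log form `TracialDecay20`, value `≤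
n^{−a·D(n)}` in the budget `r²·n < n^{a·D(n)}`,
is formally STRONGER — `TracialDecayExp20_of_TracialDecay20`,
Theorems/ChebyshevTracialDesignExpOfLog.lean — and is banked as an aside, not
staffed.) With the psd hyperplane bound (support `PsdHyperplaneBound`, Briët–Dadush–Pokutta
rescaling; PROVED) and the double count
`⟨W,S⟩ = 1` inside the proved seam `Assembly2` this gives psd rank `≥ exp(c·n^{1/4})` with `c =
a/(4(p+2))`, i.e. the leaf with `δ = 1/4`.
Lean: `(∃ a : ℝ, 0 < a ∧ ∃ n₁ : ℕ, ∀ n : ℕ, n₁ ≤ n → Even n → ∀ (t : ℕ) (C : Finset ℕ) (w : ℕ → ℝ),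
Literature.Combinatorics.Optimization.IsBalancedDesign n t (Literature.Combinatorics.Optimization.Tq
n) (Literature.Combinatorics.Optimization.dq n) 20 C w → ∀ r : ℕ, 0 < r → (r : ℝ) ^ 2 * n < Real.exp
(a * (Literature.Combinatorics.Optimization.dq n : ℝ)) →
Literature.Combinatorics.Optimization.TracialValueLEAt
(Literature.Combinatorics.Optimization.levelWeight n t C w) (Real.exp (-(a *
(Literature.Combinatorics.Optimization.dq n : ℝ)))) r) ∧
Literature.Combinatorics.Optimization.ChebyshevDesignExistsBal 20`

## Assembly
Pure logic inside the deciding theorem (rev ≥ 3; closes_target = the REGISTERED rung leaf F-N2):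
`closes (hE : TracialDecayExp20) (h3 : ChebyshevDesign20) (hT : PsdHyperplaneBound) (hA : Assembly2)
: Summit.PneNP.MatchingPsdRank.MatchingPsdRankStretchedExp`
— `hA hT hE h3 : Target`, then `delta Target` (the route decl `Target` is the leaf token-for-token).
Four binders because `Assembly2_proof`'s module
imports the route file, so the proved seam enters as a hypothesis; `Assembly2`, `ChebyshevDesign20`
and `PsdHyperplaneBound` are CLOSED (proved), so
the OPEN cone is exactly {`TracialDecayExp20`}. Inside `Assembly2`
(Summit.PneNP.PneNP.Theorems.Assembly2_proof @ 3fdeaaedc012): destructure `p` from the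
hyperplane bound and `a` from the decay; `δ = 1/4`, `c = a/(4(p+2))`; for even `n ≥ n₀` and `r <
exp(c·n^{1/4})` one has `r²·n < exp(a·dq n)` (since
`dq n > n^{1/4} − 1`), so the design weight `W` of `ChebyshevDesign20` has tracial value `≤
exp(−a·dq n)` in dimension `r`, and a psd factorization of
size `r` would give `1 = ⟨W,S⟩ ≤ r^p·n²·exp(−a·dq n) < 1`. The item `Assembly` (rev 5:
`TracialDecayExp20 → ChebyshevDesign20 → MatchingPsdRankStretchedExp`)
is CLOSED (Theorems/ChebyshevTracialDesignAssembly.lean: `fun hE h3 => closes hE h3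
PsdHyperplaneBound_proof Assembly2_proof`). Asides (banked, not in
the cone, never staffed): `TracialDecay20` (stmt-PneNP-19646, log form, open) and
`StretchedExpAssembly` (stmt-PneNP-19801, log-form seam, proved).

CLOSES_TARGET: closes rung F-N2 of PneNP: Summit.PneNP.MatchingPsdRank.MatchingPsdRankStretchedExp (D-0061; not the summit Statement) — the deciding theorem of this route concludes that registered leaf instead of the Statement decl `PneNP` (class rung: servable and labelled, never counted as concluding the summit Statement).

Rationale: WHY THIS LINE. Mechanism: Rothvoß's hyperplane-separation proof of `xc(P_PM) ≥ 2^{Ω(n)}`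
(Rothvoss2017, §2–3: a two-level weight `W = μ_{Q_3} − μ_{Q_k}/(k−1)`
with `⟨W,S⟩ = 1` and `⟨W,R⟩ ≤ 2^{−δn}` on rectangles) is lifted to psd factorizations through the
Briët–Dadush–Pokutta rescaling
(BrietDadushPokutta2014 Thm. 6: size-r psd factors of a `[0,Δ]`-matrix can be taken of operator norm
`≤ √(rΔ)`, so `⟨W,S⟩ ≤ r²·Δ·(tracial
value of W)`) — the noncommutative analogue Gribling–de Laat–Laurent ask for
(GriblingDelaatLaurent2019, concluding remarks). The cell's
negative results N3/N4 (ROUND-1) show that ℓ planted levels certify at most `n^{O(ℓ)}` against psd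
strategies (Hadamard squares of level
profiles) and that fixed-degree Lagrange designs leak at `ℓ` pins; the new lever is an EXACT
EXTRAPOLATION DESIGN on `≍ √n` levels of
exactness degree `D ≍ n^{1/4}` with BOUNDED total variation — available precisely in the Chebyshev
regime `D² ≲ T` of polynomial growth at
equally spaced points (CoppersmithRivlin1992) — which prices every strategy whose level profile is a
polynomial of degree `≤ D` at the
virtual level 0 (moment/tensor-power strategies: immune by Grigoriev's knapsack positivity,
Grigoriev2001TCS, tree fact
`Grigoriev2001_knapsackFormNonneg`; S_n-equivariant strategies in the dimension budget: immune, cell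
E1) and damps the degree `> 2D`
spherical components by `n^{−(3/8−o(1))D}` (cell (ATT), referee-passed sublemma (θ)). Imported
areas: approximation theory (discrete
Chebyshev/Markov extrapolation), noncommutative polynomial optimisation (tracial moments),
association-scheme harmonic analysis on
(t-sets × perfect matchings). What it does that prior routes / the negatives index do not: no PneNP
route bounds the GENERAL psd rank of
an explicit polytope (the sibling rung route EquivariantThetaLift is symmetry-restricted); the
negatives index has no psd-rank statement.

RANKED CRUXES. #0 Target (target) — rung F-N2 leaf, token-for-token the body of
`Summit.PneNP.MatchingPsdRank.MatchingPsdRankStretchedExp` (p404813; `Target ↔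
Summit.PneNP.MatchingPsdRank.MatchingPsdRankStretchedExp` is `Iff.rfl`): there are δ > 0, c > 0, n₀
with: for every even n ≥ n₀ the odd-cut slack matrix of the perfect matching polytope of K_n has no
psd factorization of size r < exp(c·n^δ). Declared as the route's own decl so that the route file
imports Literature only (lane B, director D-0061 alt-closer = rung leaf; registry label «closes rung
F-N2 of PneNP», never summit credit). [deps: TracialDecayExp20, ChebyshevDesign20,
PsdHyperplaneBound, Assembly2] [difficulty: XL] (why it might fail: it is the open rung itself: a
psd lift of the matching polytope of size 2^{o(n^{1/4} log n)} exact on the small crossing levels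
would refute it together with TracialDecayExp20 (KaniewskiLeeDewolf2015 Thm 19 allows 2^{O(n^{3/4}
log² n)} approximate lifts only).) [BraunEtAl2016, KaniewskiLeeDewolf2015, Rothvoss2017]
#2 TracialDecayExp20 (crux, stmt-PneNP-19878; THE deciding crux since rev 3) — for some a > 0 and
all large even n, every balanced exact design of degree dq n on
odd levels ≤ Tq n with total variation ≤ 20 has tracial value ≤ exp(−a·dq n) on tight-orthogonal psd
rectangles of every dimension r ≥ 1 with r²·n <
exp(a·dq n) (EXP-normalised dimension-restricted tracial decay; the D-mode, height-√n, psd analogue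
of Rothvoß's rectangle lemma; in this normalisation every
threshold of the programme is constant-scale: spread parameter O(1), Keevash–Lifshitz level-d
inequalities arXiv:2307.15030 Thm 1.8, Kupavskii–Zakharov spread
approximation arXiv:2203.13379 Lemma 11). [difficulty: XL] (why it might fail: junta positivity is
settled (virtual level = Grigoriev⊗Grigoriev, PSD to degree Ω(n));
the heart (N2) is an UN-LIFTED 'psd strategies ≈ aligned junta ⊗ spread mixtures' theorem at
accuracy exp(−aD): KMR17/GLMWZ16/LRS15 get such structure only via
gadgets, Rothvoß only for r = 1 with Θ(n) pins.) [Rothvoss2017, KothariMekaRaghavendra2021,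
GoosEtAl2016, LeeRaghavendraSteurer2015, Grigoriev2001TCS, KaniewskiLeeDewolf2015,
GriblingDelaatLaurent2019, BrietDadushPokutta2014, arXiv:2307.15030, arXiv:2203.13379]
Aside (banked, not staffed, not in the cone): TracialDecay20 (stmt-PneNP-19646) — the LOG form
(value ≤ n^{−a·dq n} in the budget r²·n < n^{a·dq n}), formally
stronger (`TracialDecayExp20_of_TracialDecay20`, Theorems/ChebyshevTracialDesignExpOfLog.lean); kept
as a settled-text record, never re-wanted.
#3 ChebyshevDesign20 (crux; CLOSED — proved by Summit.PneNP.PneNP.Theorems.ChebyshevDesign20_proof @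
eac0f0ad8e10) — for all large even n there are an odd balanced cut size t (n/4 ≤ t, 2t+2 ≤ n, Tq n ≤
t), a set C of odd levels in [3, Tq n] with nonempty level classes, and weights w with Σ_c w_c (c−1)
= 1, Σ_c w_c p(c) = −p(0) for every real polynomial p of degree ≤ dq n, and Σ_c |w_c| ≤ 20 (exact
extrapolation design in the Chebyshev regime dq n² ≤ Tq n/4; explicit witness: C = {3 + 4sj² : j ≤
dq n}, s = ⌊⌊√n⌋/(dq n)²⌋, w = minus the Lagrange extrapolation coefficients to the virtual level 0,
Σ|w| ≤ 11.91). [difficulty: M] (why it might fail: approximation settled on paper (ROUND-3 §2.12: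
nodes 3+4sj², Lagrange weights, Σ|w| ≤ 11.91 < 20; exact check n ≤ 10⁸); what can still fail is the
typed side data — Q_c ≠ ∅ at every node with balanced odd t, Tq n ≤ t (n ≥ ~100, absorbed by n₀): a
typing slip in IsExactDesign, not the mathematics.) [CoppersmithRivlin1992, arXiv:1902.02398,
Rothvoss2017]
#9 PsdHyperplaneBound (support; CLOSED — `PsdHyperplaneBound_proof`,
Theorems/ChebyshevTracialDesignPsdHyperplaneBound.lean) — the tracial hyperplane bound at the
dimension of the factorization with polynomial loss: for some p, every S ≤ Δ (0 ≤ Δ) vanishing on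
the tight pairs with a psd factorization of size r and every W of tracial value ≤ γ in dimension r
satisfy ⟨W,S⟩ ≤ r^p·Δ·γ (p = 2: Briët–Dadush–Pokutta Thm. 6 via John's theorem; p = 3: elementary
Auerbach rescaling, being vendored by the cell's literature seat as
`HasPsdFactorization.rescale_weak`). [difficulty: provable-now] [BrietDadushPokutta2014,
GriblingDelaatLaurent2019, Rothvoss2017]
#9 Assembly2 (assembly-kind seam; CLOSED — Summit.PneNP.PneNP.Theorems.Assembly2_proof @
3fdeaaedc012) — PsdHyperplaneBound → TracialDecayExp20 →
ChebyshevDesign20 → Target: destructure p and a; δ = 1/4, c = a/(4(p+2)); for even n ≥ n₀ and r <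
exp(c·n^{1/4}), r²·n < exp(a·dq n) (dq n > n^{1/4} − 1);
with W the design weight (⟨W,S⟩ = Σ_c w_c (c−1) = 1 by double counting over the level classes, S ≤
n² by the tree's `cc_sub_one_le`, S = 0 on tight pairs) a
psd factorization of size r gives 1 = ⟨W,S⟩ ≤ r^p·n²·exp(−a·dq n) < 1 for n ≥ n₀. [difficulty: done]
[Rothvoss2017, BrietDadushPokutta2014]
#1 Assembly (assembly; CLOSED 2026-08-26 — `ChebyshevTracialDesign_Assembly_proof`,
Theorems/ChebyshevTracialDesignAssembly.lean) — TracialDecayExp20 →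
ChebyshevDesign20 → MatchingPsdRankStretchedExp (rev-5 restatement of the rev-1 tauto-trivial
record; = `fun hE h3 => closes hE h3 PsdHyperplaneBound_proof
Assembly2_proof`). Aside (banked, proved): StretchedExpAssembly (stmt-PneNP-19801) — the log-form
seam, proved
(Theorems/ChebyshevTracialDesignStretchedExpAssembly.lean), superseded in the cone by Assembly2.

TWO-LAYER PLAN. TracialDecayExp20 ⇐ ProfileAttenuation → VirtualPositivity → TracialDecayExp20 (the
BC3 skeleton bc/TracialDecay20_birth.lean is the kernel-checked
composition for the log form; the exp form is the same two stubs with the threshold n^{−aD} replaced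
by exp(−aD) — note n^{−D/4} ≤ exp(−aD) once ln n ≥ 4a —
and its re-registration as bc/TracialDecayExp20_birth.lean on stmt-PneNP-19878 is the tenure seat's
first deliverable): ProfileAttenuation (ATT/H_D) = the level profile `Φ(c) = E_{Q_c} tr(X_U Y_M)/r`
of every psd rectangle is within `n^{−D/4}`
on the design's nodes of a polynomial of degree `≤ D = dq n` (Johnson-scheme expansion `Φ = Σ_{k
even} σ_k(c) β_k`, `deg_c σ_k = k/2`,
`Σ|β_k| ≤ 1`, and the pin-counting bound `σ_k(c)² ≤ (4/n)^{k/2}/θ_k` with the referee-passed `θ_k ≥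
e^{−1/2}/(k−1)!!`);
VirtualPositivity (VIRT_D) = for rectangles in the dimension budget every such approximating
polynomial has `−p(0) + 20·n^{−D/4} ≤
n^{−aD}` (the open heart: tight-orthogonality must forbid a negative virtual level).
ChebyshevDesign20 ⇐ ChebyshevWeights (pure
approximation theory on the nodes {3,5,…,T}, 4D² ≤ T) → BalancedCutsFeasible (odd t next to n/2 − 1;
every odd level 3 ≤ c ≤ Tq n has a
nonempty class) → ChebyshevDesign20 (skeleton bc/ChebyshevDesign20_birth.lean). VirtualPositivity
itself splits as (N1) LOCAL VIRTUAL POSITIVITY — junta psd strategies (X_U = F(U ∩ A), Y_M =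
G(M-edges at A),
|A| ≤ D, any dimension, tight or not) have design value ≤ 0 EXACTLY, because the conditional law of
a local pattern given cc = c is the
polynomial `∏ 1/(n−1−2j) · 2^{−y}[c]_y[(t−c)/2]_z[(n−t−c)/2]_{x−y−z}/[n/2]_x` of degree x ≤ |A|
whose value at the virtual level is ≥ 0
(paper-proved, exact-rational check; BC5 rung `stub_rung_juntaVirtual`) — and (N2) JUNTA-OR-SPREAD
STRUCTURE — every tight strategy in
the dimension budget has a low-level profile within n^{−aD}/20 of a nonnegative mixture of junta
profiles (the D-mode Razborov–Rothvoß
structure step; open). Nothing of this second layer is filed as items; what HAS landed toward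
TracialDecayExp20 is by-name support (Theorems/ChebyshevTracialDesign*.lean, 61 sorry-free
files as of 2026-08-26T12:46Z, `--supports stmt-PneNP-19878` or earlier items), notably: ExpOfLog
(log ⇒ exp); JuntaVirtualPositivity, JuntaMatchingVirtualPositivity,
LowDegreeHolds (the N1 / low-degree side); DimensionOne, Commutative, BoundedDimension,
BlockDiagonal (shadows of the crux); HarmonicLayers, TightOddLayers,
TightEvenEigenvalues, TightSecondEigenvalue, TightFreeSpectral, RectangleBiMode, DesignValueBiMode
(the Johnson-scheme spectral layer of the tight Gram kernel and the
bi-mode expansion of the design value — the σ_k layer in the kernel); ClosedPairCount,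
TransversalSquareSum, DipoleSquareSum, DipoleHitBound (the dipole route to
(ATT), uniform in the level); LevelCountObstruction, LevelCountFooling, LevelCountOneSigned (what
level statistics alone cannot certify).

KILL CRITERIA. An explicit family of tight-orthogonal psd rectangles of dimension `n^{o(dq n)}` with
value `≥ n^{−o(dq n)}` against balanced B = 20
Chebyshev designs refutes TracialDecayExp20 (a fortiori the banked TracialDecay20) for every a and
closes the route (refuted:TracialDecayExp20); so does a refutation of its classical
shadow `RectangleDecayBal a 20` for all a (0/1 rectangles avoiding Q_1 with design mass ≥ n^{−o(D)})
— the line then dies at Rothvoß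
strength already. A refutation of ChebyshevDesign20 that only breaks the constant 20 forces a
restatement with the certified variation
bound B (both items, same B), not a closure. A psd factorization of size `2^{o(n^{1/4} log n)}` of a
matrix agreeing with S on all levels
`≤ 4√n+3` and vanishing on the tight pairs (a KLdW-type construction at ε = 1/4 with EXACT small
levels and sub-ceiling size) kills the
mechanism outright. Mooted if EquivariantThetaLift's methods unexpectedly extend to general
factorizations (not expected).

NOT DECOMPOSED YET. The Johnson-scheme spectral expansion (σ_k, β_k, the two-row isotypic
intertwiners between functions on t-sets and on perfect matchings),
the attenuation constants (3/8 vs 1/4), the choice of a (any a ≤ 1/8 suffices for the leaf), the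
deep-component regime k > n/4 of the
attenuation bound, and the approximation-theory constants behind B = 20 are layer-2 material; the
arithmetic thresholds n₀ are settled (Assembly2_proof, StretchedExpAssembly_proof). The exponent δ =
1/4 is what this design family gives; 2^{Ω(n)} (Rothvoß strength) is NOT claimed — it
would need unbounded-variation designs on ≍ n levels, outside this route.
Settled on paper since filing (ROUND-3 §2.10–2.16): the design family (explicit nodes 3+4sj², Σ|w| ≤
11.91), the attenuation
(ATT), and nonpositivity of the value on junta / low-degree-FACTOR strategies for every r (virtual
level = Grigoriev⊗Grigoriev
pseudo-matching, PSD); the single open statement inside TracialDecayExp20 is the spread-part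
structure theorem (N2) —
HOME/pnp-psdrank-p1/N2-SpreadStructure.md — which is where the first tenure split will cut.

CHEAPEST FALSIFIER. STRUCTURAL (ROUND-3 §2.16, zero-margin locus): tight sub-rectangles X'×Y' of a
crossing-pinned junta (splitters(e₁e₂e₃) ×
{M ⊇ e₁e₂e₃}; there V = 0 EXACTLY and every junta refinement keeps V = 0) whose column statistic
depends NON-smoothly on the level
c on many rows — a positive residual > n^{−aD} refutes RectangleDecayBal a 20 for all a and with it
TracialDecayExp20; psd version: a
NON-equivariant small-dimension tight strategy whose profile's degree-D extrapolation to the virtual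
level is < −n^{−aD}
(equivariant and low-degree-factor strategies cannot: value ≤ 0 exactly, §2.15). NUMERICAL (eng,
kit; F3/F4): at n = 18…26 with
the certified small designs maximise the value over tight 0/1 rectangles (exact ILP) / psd
rectangles r ≤ 4 (see-saw SDP from
non-equivariant starts); since n ≤ 26 lies below the a-priori bound 13·n^{−3/2}, these test
STRUCTURE — are maximisers junta-like,
does max V scale like the (D+1)-pin leak ≈ n^{−1.8(D+1)} (this seat's pinscan: 0 for ≤ D pins) or
like a fixed power? A non-junta maximiser family with V ≍ n^{−const} refutes TracialDecayExp20.
RUNNING (tribunal J 401c5c4a feedback (2), refutation budget first):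
eng kit job j254251 RBUDGET-A — ONE job sweeping finite-SDP instances of TracialValueLEAt at (n,t) ∈
{(8,3),(10,3),(10,5),(12,5)}, small r, surrogate exact
designs, tight psd see-saw with exact half-steps; FOUND (a route event) / NOT-FOUND with the
instance list is posted by eng in pub/pnp-psdrank/STATUS.md.

NUMBERS. Census of record (eng MEMO-1, referee two-lineage PASS): 37 ≤ psd-rank PM(K₁₀) ≤ 78, 56 ≤
psd-rank PM(K₁₂) ≤ 187; equivariant upper
companion eq-psd-rank(odd-cut K_n) ≤ Catalan(n/2) (lit LIT-4, all even n). Designs (kit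
j242506/j242815/j243136, exact rationals): minimal
Σ|w| for exactness degree D on odd nodes 3..T is 13–16 at D²/T ≈ 0.8–1 up to T = 403 (T = 403, D =
20: 16.19) and grows like e^{cD²/T}
beyond (CoppersmithRivlin1992), hence D = dq n ≍ n^{1/4} at T = Tq n ≍ n^{1/2} and the bound
2^{Θ(n^{1/4} log n)}. Attenuation: θ_k =
(1/(k−1)!!)·∏_{i<k/2}(1 − 1/(n−k+1−2i)) ≥ e^{−1/2}/(k−1)!! (lit LIT-5, referee PASS) ⇒ tail beyond
degree 2D ≤ 20·(8(D+1)/n)^{(D+1)/2}.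
Virtual-level ratios ρ_k = σ_k(0)/σ_k(1) − 1 ≈ 2k/n (n = 80: 0.052, 0.110, 0.174 for k = 2,4,6;
HOME/pnp-psdrank-p1/num/sigma_k.py).
Ceiling: approximation-robust arguments reading only levels ≤ (n/2)^{2ε} prove at most
2^{C·n^{1/2+ε}·log² n} (KaniewskiLeeDewolf2015
Thm 19; here ε = 1/4 + o(1), ceiling 2^{Õ(n^{3/4})}, claimed exp(c·n^{1/4}) from the exp-form cone —
the banked log form would give 2^{Θ(n^{1/4} log n)}).

DEFINITION REQUESTS. None new beyond the vocabulary file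
`Literature/Combinatorics/Optimization/TracialDesigns.lean` (IsPsdRect, TracialValueLEAt,
TracialHyperplaneBoundAt, levelWeight, levelProfile, dq, Tq, IsExactDesign, IsBalancedDesign,
ChebyshevDesignExistsBal, TracialDecayDimBal,
RectangleDecayBal, MultilevelTracialBoundDim, ExpTracialBoundDim, expTracialBoundDim_of_bal; farm rc
0; filing WANTED ps-lit 2026-08-25
19:48Z). Foreseen later (tenure, not now): the Johnson-scheme spherical functions σ_k on (t-sets ×
perfect matchings) as a Literature
definition, needed to file ATT/VIRT as items.

Novelty: Searches (2026-08-25, this seat; earlier sessions' searches in HOME/pnp-psdrank-p1/ROUND-1..3-PREP):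
lit search --hybrid "psd rank perfect matching polytope lower bound hyperplane separation" (8 docs,
all textbooks/IPCO volumes, none on topic); lit vsearch "noncommutative or tracial sum-of-squares
certificate proving an exponential lower bound on the psd rank of the perfect matching polytope
slack matrix" (8, none on topic); lit galaxy search "psd rank|semidefinite extension
complexity|positive semidefinite rank" --star all (20 rows: [galaxy:pdf:-8425364293953307240] J. R.
Lee's Bonn notes on SDP extended formulations and SOS, [galaxy:pdf:-3148384051449748460]
Lee–Prakash–de Wolf–Yuen on SOS degree of symmetric quadratic functions,
[galaxy:pdf:5253233483746675720] Gouveia–Parrilo–Thomas approximate cone factorizations,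
[galaxy:pdf:6392657116885730360] Lee–Wei sqrt-rank; no tracial/psd hyperplane-separation bound for
matchings); lit galaxy search "matching polytope|Rothvoss|hyperplane separation" --star pdf (10,
none beyond LP-side); lit search --hybrid "Chebyshev polynomial extrapolation equally spaced points
discrete design bounded coefficients" (6 numerical-methods books; Coppersmith–Rivlin located via
doi:10.1137/0523054 and added to references.bib); lit read arxiv:1305.3268 --grep rescal (BDP Thm 6
confirmed, [corpus:paper-arxiv-1305.3268 p7]).
Nearest prior art found: GriblingDelaatLaurent2019 (doi:10.1007/s10208-018-09410-y) §5 + concluding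
remarks — the tracial hierarc  [refs: 10.1137/0523054, 10.1007/s10208-018-09410-y, 1305.3268, doi:10.1137/0523054, arxiv:1305.3268, paper-arxiv-1305.3268, doi:10.1007/s10208-018-09410-y, GriblingDelaatLaurent2019, LeeRaghavendraSteurer2015, BrietDadushPokutta2014, KaniewskiLeeDewolf2015, Rothvoss2017]

Barriers (technique_class: tracial-hyperplane-separation, chebyshev-design, nc-sos): - technique_class: tracial-hyperplane-separation, chebyshev-design, nc-sos
- Approximation ceiling of Kaniewski–Lee–de Wolf 2015 Thm 19 (tree file
Literature/Barriers/PneNP/MatchingSlackPsdApproximation.lean, decls `KaniewskiLeeDewolf2015_thm19`,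
`IsApproxRobustPsdBound`; not yet an A-entry of BarrierCatalogue.lean, hence cited in prose): the
line sits INSIDE the approximation-robust class `IsApproxRobustPsdBound n ε` for every ε with
(n/2)^{2ε} ≥ 4√n+3 (ε = 1/4 + o(1)): W reads only levels ≤ Tq n, which every (ε,n)-admissible
perturbation leaves EXACT, and has variation 20, so ⟨W,S̃⟩ = ⟨W,S⟩ = 1 and the same bound is
certified for S̃; it is consistent with `KaniewskiLeeDewolf2015_thm19.ceiling` because the claimed
2^{Θ(n^{1/4} log n)} is below the ceiling 2^{C n^{3/4+o(1)} log² n} at that ε — the route does not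
claim 2^{Ω(n^{1/2+ε})}, and says so in the leaf's docstring checkpoint.
- Literature.Barriers.PneNP.TSPExtensionComplexityNarrow: (A43; with A42
`Literature.Barriers.PneNP.TSPExtensionComplexity` = the Rothvoß theorem itself, whose level classes
the route imports) Rothvoß/Yannakakis bounds are LP-only (nonnegative rank); the route re-proves
nothing LP-side and imports only the combinatorial level classes Q_c and the double count ⟨W,S⟩ = 1
from the Rothvoß files; the psd content is entirely in TracialDecay20.
- Literature.Barriers.PneNP.NaturalProofs: not applicable — extension complexity of an explicit
polytope, no circuit lower bound is claimed (the rung is never sum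

History (route lifecycle, newest last):
- 2026-08-25T22:21:23Z · rev 1: restated StretchedExpAssembly (stmt-PneNP-19649) — staffability repair: `ledger route show` reports «staffable: NO — 1 unproved dep in the cone: Literature.Combinatorics.Optimization.ExpTracialBoundDim [cite_onl (planner-pnp-psdrank-p1-g2-0)
- 2026-08-26T12:27:27Z · closes_target -> closes rung F-N2 of PneNP: Summit.PneNP.MatchingPsdRank.MatchingPsdRankStretchedExp (D-0061; not the summit Statement) (planner-pnp-psdrank-p1-g3-0)
- 2026-08-26T12:38:26Z · rev 5: restated Assembly (stmt-PneNP-19650) — No11b J 401c5c4a feedback (1): Assembly stmt-PneNP-19650 ground.trivial; gate refuses --drop/ --retriage of the assembly item ('restate it'), so restated as Trac (planner-pnp-psdrank-p1-g3-0)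
- 2026-09-03T21:13:03Z · DORMANT — reconciler: no traction for 5 d (last activity item-evidence-added at 2026-08-29T20:26:59Z); parked, not closed — `ledger route dormant route-PneNP-ChebyshevTra (operator:999:1805635)

sub-problem: PneNP · status: dormant · opened planner-pnp-psdrank-p1-g2-0 2026-08-25T22:03:28Z · rev 6 · ledger route-PneNP-ChebyshevTracialDesign
GENERATED by the gate from the ledger (D-0016/17). Provers cite these decls: `theorem foo : Summit.PneNP.PneNP.Theses.ChebyshevTracialDesign.<Decl> := …` in Summits/PneNP/PneNP/Theorems/<Name>.lean.
-/

namespace Summit.PneNP.PneNP.Theses.ChebyshevTracialDesign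

open scoped BigOperators Topology Manifold Classical MeasureTheory ProbabilityTheory Matrix InnerProductSpace ComplexConjugate ContinuousMap
open Filter Set Function TopologicalSpace MeasureTheory

attribute [summit_statement] _root_.PneNP
attribute [summit_statement] _root_.Summit.PneNP.MatchingPsdRank.MatchingPsdRankStretchedExp

open Literature.PNP

/-- item stmt-PneNP-19645 · target · rank 0 · open · by planner
why it might fail: it is the open rung itself: a psd lift of the matching polytope of size 2^{o(n^{1/4} log n)} exact on the small crossing levels would refute it together with TracialDecay20 (KaniewskiLeeDewolf2015 Thm 19 allows 2^{O(n^{3/4} log² n)} approximate lifts only).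
sources: BraunEtAl2016, KaniewskiLeeDewolf2015, Rothvoss2017
[target] rung F-N2 leaf, token-for-token the body of
`Summit.PneNP.MatchingPsdRank.MatchingPsdRankStretchedExp` (p404813; `Target ↔
Summit.PneNP.MatchingPsdRank.MatchingPsdRankStretchedExp` is `Iff.rfl`): there are δ > 0, c > 0, n₀
with: for every even n ≥ n₀ the odd-cut slack matrix of the perfect matching polytope of K_n has no
psd factorization of size r < exp(c·n^δ). Declared as the route's own decl so that the route file
imports Literature only (lane B, director D-0061 alt-closer = rung leaf; registry label «closes rung
F-N2 of PneNP», never summit credit). [deps: TracialDecay20, ChebyshevDesign20, PsdHyperplaneBound,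
StretchedExpAssembly] [difficulty: XL] -/
@[route_item "route-PneNP-ChebyshevTracialDesign"]
def Target : Prop :=
  ∃ δ : ℝ, 0 < δ ∧ ∃ c : ℝ, 0 < c ∧ ∃ n₀ : ℕ, ∀ n : ℕ, n₀ ≤ n → Even n → ∀ r : ℕ, (r : ℝ) < Real.exp (c * (n : ℝ) ^ δ) → ¬ Literature.Combinatorics.Optimization.HasPsdFactorization (Literature.Barriers.PneNP.pmOddCutSlack n) r

/-- item stmt-PneNP-19878 · crux · rank 2 · open · by planner
[crux] EXP-NORMALISED dimension-restricted tracial decay: for some a > 0 and all large even n, every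
balanced exact design (degree dq n on odd levels ≤ Tq n, Σ_c |w_c| ≤ 20) has tracial value ≤
exp(−a·dq n) on tight-orthogonal psd rectangles (0 ⪯ X_U, Y_M ⪯ I, X_U·Y_M = 0 whenever cc(U,M) = 1)
of every dimension r with r²·n < exp(a·dq n). Formally WEAKER than TracialDecay20 (kernel-checked
`exp_of_log : TracialDecay20 → TracialDecayExp20` in HOME/pnp-psdrank-p1/route-B/Sketch_exp.lean,
farm rc 0) and still gives Target with δ = 1/4, c = a/(4(p+2)). Point of the normalisation: every
threshold of the cell's CPD programme becomes constant-scale (spread parameter τ = O(1);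
Keevash–Lifshitz level-d inequality arXiv:2307.15030 Thm 1.8 and balanced-slice hypercontractivity
at density exp(−Θ(n^{1/4})); junk exp(−a·dq n)), and the r = 1 shadow has a complete proof sketch
(HOME/pnp-psdrank-p1/N2-SpreadStructure.md §SNT: Kupavskii–Zakharov spread approximation
arXiv:2203.13379 Lemma 11 on the matching side + crossing-pattern pieces (L2) + spectral
non-tightness of dense × homogeneous pairs); at threshold n^{−a·dq n} that spectral step fails by an
(a·ln n)² factor (threshold families saturate -/
@[route_item "route-PneNP-ChebyshevTracialDesign"]
def TracialDecayExp20 : Prop :=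
  ∃ a : ℝ, 0 < a ∧ ∃ n₁ : ℕ, ∀ n : ℕ, n₁ ≤ n → Even n → ∀ (t : ℕ) (C : Finset ℕ) (w : ℕ → ℝ), Literature.Combinatorics.Optimization.IsBalancedDesign n t (Literature.Combinatorics.Optimization.Tq n) (Literature.Combinatorics.Optimization.dq n) 20 C w → ∀ r : ℕ, 0 < r → (r : ℝ) ^ 2 * n < Real.exp (a * (Literature.Combinatorics.Optimization.dq n : ℝ)) → Literature.Combinatorics.Optimization.TracialValueLEAt (Literature.Combinatorics.Optimization.levelWeight n t C w) (Real.exp (-(a * (Literature.Combinatorics.Optimization.dq n : ℝ)))) r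

/-- item stmt-PneNP-19647 · crux · rank 3 · closed · proved by Summit.PneNP.PneNP.Theorems.ChebyshevDesign20_proof @ e3ac6f88013e (prover) · by planner
why it might fail: approximation settled on paper (ROUND-3 §2.12: nodes 3+4sj², Lagrange weights, Σ|w| ≤ 11.91 < 20; exact check n ≤ 10⁸); what can still fail is the typed side data — Q_c ≠ ∅ at every node with balanced odd t, Tq n ≤ t (n ≥ ~100, absorbed by n₀): a typing slip in IsExactDesign, not the mathematics.
sources: CoppersmithRivlin1992, arXiv:1902.02398, Rothvoss2017
[crux] for all large even n there are an odd balanced cut size t (n/4 ≤ t, 2t+2 ≤ n, Tq n ≤ t), a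
set C of odd levels in [3, Tq n] with nonempty level classes, and weights w with Σ_c w_c (c−1) = 1,
Σ_c w_c p(c) = −p(0) for every real polynomial p of degree ≤ dq n, and Σ_c |w_c| ≤ 20 (exact
extrapolation design in the Chebyshev regime dq n² ≤ Tq n/4; explicit witness: C = {3 + 4sj² : j ≤
dq n}, s = ⌊⌊√n⌋/(dq n)²⌋, w = minus the Lagrange extrapolation coefficients to the virtual level 0,
Σ|w| ≤ 11.91). [difficulty: M] -/
@[route_item "route-PneNP-ChebyshevTracialDesign"]
def ChebyshevDesign20 : Prop :=
  Literature.Combinatorics.Optimization.ChebyshevDesignExistsBal 20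

-- `ChebyshevDesign20` holds: proved by `Summit.PneNP.PneNP.Theorems.ChebyshevDesign20_proof` @ e3ac6f88013e (its module imports this route file, so no `_holds` link can be stated here).

/-- item stmt-PneNP-19646 · aside · rank 2 · open · by planner
why it might fail: junta positivity is settled (virtual level = Grigoriev⊗Grigoriev, PSD to degree Ω(n)); the heart (N2) is an UN-LIFTED 'psd strategies ≈ aligned junta ⊗ spread mixtures' theorem at accuracy n^{−aD}: KMR17/GLMWZ16/LRS15 get such structure only via gadgets, Rothvoß only for r = 1 with Θ(n) pins.
sources: Rothvoss2017, KothariMekaRaghavendra2021, GoosEtAl2016, LeeRaghavendraSteurer2015, Grigoriev2001TCS, KaniewskiLeeDewolf2015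
[crux] for some a > 0 and all large even n, every balanced exact design of degree dq n on odd levels
≤ Tq n with total variation ≤ 20 has tracial value ≤ n^{−a·dq n} on tight-orthogonal psd rectangles
of every dimension r with r²·n < n^{a·dq n} (dimension-restricted tracial decay; the D-mode,
height-√n, psd analogue of Rothvoß's rectangle lemma). [difficulty: XL] -/
@[route_item "route-PneNP-ChebyshevTracialDesign"]
def TracialDecay20 : Prop :=
  ∃ a : ℝ, 0 < a ∧ Literature.Combinatorics.Optimization.TracialDecayDimBal a 20

/-- item stmt-PneNP-19648 · support · rank 9 · closed · proved by Summit.PneNP.PneNP.Theorems.PsdHyperplaneBound_proof @ e3ac6f88013e (prover) · by planner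
sources: BrietDadushPokutta2014, GriblingDelaatLaurent2019, Rothvoss2017
[support] the tracial hyperplane bound at the dimension of the factorization with polynomial loss:
for some p, every S ≤ Δ (0 ≤ Δ) vanishing on the tight pairs with a psd factorization of size r and
every W of tracial value ≤ γ in dimension r satisfy ⟨W,S⟩ ≤ r^p·Δ·γ (p = 2: Briët–Dadush–Pokutta
Thm. 6 via John's theorem; p = 3: elementary Auerbach rescaling, being vendored by the cell's
literature seat as `HasPsdFactorization.rescale_weak`). [difficulty: provable-now] -/
@[route_item "route-PneNP-ChebyshevTracialDesign"]
def PsdHyperplaneBound : Prop :=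
  Literature.Combinatorics.Optimization.TracialHyperplaneBoundAt

-- `PsdHyperplaneBound` holds: proved by `Summit.PneNP.PneNP.Theorems.PsdHyperplaneBound_proof` @ e3ac6f88013e (its module imports this route file, so no `_holds` link can be stated here).

-- earlier StretchedExpAssembly (stmt-PneNP-19649, replaced 2026-08-25T22:21:23Z -> stmt-PneNP-19801): retired by None — Literature.Combinatorics.Optimization.TracialHyperplaneBoundAt → Literature.Combinatorics.Optimization.ExpTracialBoundDim → Target
/-- item stmt-PneNP-19801 · aside · rank 9 · closed · proved by Summit.PneNP.PneNP.Theorems.StretchedExpAssembly_proof @ e3ac6f88013e (prover) · by planner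
sources: Rothvoss2017, BrietDadushPokutta2014
[support] hyperplane bound + the two cruxes ⇒ Target: (1) compose the cruxes into
`Literature.Combinatorics.Optimization.ExpTracialBoundDim` by the kernel-checked tree lemma
`expTracialBoundDim_of_bal 20 a ha`; (2) instantiate it and `TracialHyperplaneBoundAt` (p = 3) at S
= pmOddCutSlack n, Δ = n, the design weight W (⟨W,S⟩ = Σ_c w_c (c−1) = 1 by double counting over the
level classes; S ≤ n² by `cc_sub_one_le`; S = 0 on tight pairs by rfl); (3) 1 = ⟨W,S⟩ ≤
r^p·n²·n^{−a·dq n} < 1 for r < exp(c·n^{1/4}), c = a/(8(p+2)), n ≥ n₀ — arithmetic (dq n ≥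
n^{1/4}/2). Plan: HOME/pnp-psdrank-p1/PLAN-StretchedExpAssembly.md. [difficulty: provable-now, M] -/
@[route_item "route-PneNP-ChebyshevTracialDesign"]
def StretchedExpAssembly : Prop :=
  PsdHyperplaneBound → TracialDecay20 → ChebyshevDesign20 → Target

-- `StretchedExpAssembly` holds: proved by `Summit.PneNP.PneNP.Theorems.StretchedExpAssembly_proof` @ e3ac6f88013e (its module imports this route file, so no `_holds` link can be stated here).

-- earlier Assembly (stmt-PneNP-19650, replaced 2026-08-26T12:38:26Z -> stmt-PneNP-19664): retired by None — TracialDecay20 → ChebyshevDesign20 → PsdHyperplaneBound → StretchedExpAssembly → Target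
/-- item stmt-PneNP-19664 · assembly · rank 1 · closed · proved by Summit.PneNP.PneNP.Theorems.ChebyshevTracialDesign_Assembly_proof (prover) · by planner
sources: Rothvoss2017, BrietDadushPokutta2014, GriblingDelaatLaurent2019
[assembly] the two cruxes decide rung F-N2: TracialDecayExp20 → ChebyshevDesign20 →
MatchingPsdRankStretchedExp (the leaf named by closes_target), through the proved support
PsdHyperplaneBound (stmt-PneNP-19648) and the proved exp-form seam Assembly2 (stmt-PneNP-19885);
provable now in a Theorems file as `fun hE h3 => closes hE h3 PsdHyperplaneBound_proof
Assembly2_proof`. Replaces the rev-1 tauto-trivial Assembly (TracialDecay20 → ChebyshevDesign20 →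
PsdHyperplaneBound → StretchedExpAssembly → Target, ground.trivial) per J 401c5c4a feedback (1); the
gate refuses --drop / --retriage of the assembly item, so it is restated per the gate's hint. -/
@[route_item "route-PneNP-ChebyshevTracialDesign"]
def Assembly : Prop :=
  TracialDecayExp20 → ChebyshevDesign20 → Summit.PneNP.MatchingPsdRank.MatchingPsdRankStretchedExp

-- `Assembly` holds: proved by `Summit.PneNP.PneNP.Theorems.ChebyshevTracialDesign_Assembly_proof` (its module imports this route file, so no `_holds` link can be stated here).

/-- item stmt-PneNP-19885 · assembly · rank 9 · closed · proved by Summit.PneNP.PneNP.Theorems.Assembly2_proof @ 1ddba4bf36e0 (prover) · by planner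
[support] PsdHyperplaneBound → TracialDecayExp20 → ChebyshevDesign20 → Target (exp-normalised
assembly, supersedes StretchedExpAssembly in the cone): destructure p from the hyperplane bound and
a from the decay; take δ = 1/4, c = a/(4(p+2)); for even n ≥ n₀ and r < exp(c·n^{1/4}): r²·n <
exp(a·dq n) because dq n > n^{1/4} − 1 (tree lemma `rpow_quarter_lt_dq_succ`,
Theorems/ChebyshevTracialDesignStretchedExpAssembly.lean), so the design weight W = levelWeight n t
C w of the balanced design from ChebyshevDesign20 has tracial value ≤ exp(−a·dq n) in dimension r;
if pmOddCutSlack n had a psd factorization of size r then 1 = ⟨W,S⟩ (double count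
`sum_levelWeight_mul_slack`, same file; S ≤ n², S = 0 on tight pairs) ≤ r^p·n²·exp(−a·dq n) < 1 —
contradiction. Same skeleton as StretchedExpAssembly_proof (p410145) with Real.exp in place of rpow
(simpler arithmetic). Plan: HOME/pnp-psdrank-p1/PLAN-StretchedExpAssembly.md §EXP. [difficulty:
provable-now, M] SOURCES: Rothvoss2017 (§2), BrietDadushPokutta2014 (Thm 6). -/
@[route_item "route-PneNP-ChebyshevTracialDesign"]
def Assembly2 : Prop :=
  PsdHyperplaneBound → TracialDecayExp20 → ChebyshevDesign20 → Target

-- `Assembly2` holds: proved by `Summit.PneNP.PneNP.Theorems.Assembly2_proof` @ 1ddba4bf36e0 (its module imports this route file, so no `_holds` link can be stated here).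

/-! D-0027 §2.1 — DECIDING THEOREM (planner-authored via `route open/edit --closes-file`; by planner-pnp-psdrank-p1-g3-0 2026-08-26T12:27:27Z):
its hypotheses are this route's items and its conclusion the registered leaf `Summit.PneNP.MatchingPsdRank.MatchingPsdRankStretchedExp` (rung F-N2, D-0061) (glue_lint), and it elaborates with this file. -/

/-- D-0027 §2.1 / D-0061 DECIDING THEOREM of route `ChebyshevTracialDesign` against the REGISTERED rung leaf F-N2
`Summit.PneNP.MatchingPsdRank.MatchingPsdRankStretchedExp` (alt-closer table PneNP/PneNP; rung credit «closes rung F-N2 of PneNP»,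
never summit credit), rev ≥ 3. Hypotheses = the route's four load-bearing items: the EXP-normalised decay crux `TracialDecayExp20`
(stmt-PneNP-19878, the one OPEN binder), the design crux `ChebyshevDesign20` (proved), the support `PsdHyperplaneBound` (proved) and
the exp-normalised assembly `Assembly2 : PsdHyperplaneBound → TracialDecayExp20 → ChebyshevDesign20 → Target` (proved,
`Summit.PneNP.PneNP.Theorems.Assembly2_proof`). The route decl `Target` is token-for-token the leaf, so the last step is delta-unfolding. -/
@[closes "route-PneNP-ChebyshevTracialDesign"] theorem closes (hE : TracialDecayExp20) (h3 : ChebyshevDesign20) (hT : PsdHyperplaneBound)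
    (hA : Assembly2) : Summit.PneNP.MatchingPsdRank.MatchingPsdRankStretchedExp := by
  have h : Target := hA hT hE h3
  delta Target at h
  delta Summit.PneNP.MatchingPsdRank.MatchingPsdRankStretchedExp
  exact h

end Summit.PneNP.PneNP.Theses.ChebyshevTracialDesign
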